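import Literature.Geometry.Lorentzian.CurvatureRegularity
import Literature.Geometry.Lorentzian.LeviCivitaCovDerivProofs
import Literature.Geometry.Lorentzian.InitialData
import HarnessLib

/-!
# The momentum constraint of initial data on a chart domain, in coordinates; the flat case

(trunk G08 = T-LORENTZ; family `gr`; namespace `Literature.Geometry.Lorentzian.OpensChart`.)

For an initial data set `D = (h, k)` on an open subset `U` of a finite-dimensional real normed
space `E` (a manifold modelled on `𝓘(ℝ, E)` through `Opens.instChartedSpace`, the setting of
`ChartCalculus.lean`), with representatives `G, K : E → E →L E →L ℝ` of the metric and of the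
second fundamental form (`h_y = G y`, `k_y = K y`) differentiable at the point, this file proves
the classical coordinate formulas

* `OpensChart.covDeriv₂_eq` — the covariant differential of a field of bilinear forms on constant
  fields: `(∇_Z k)(X, Y)(x) = ∂_Z K(X, Y) − K(Γ_x(Z, X), Y) − K(X, Γ_x(Z, Y))`, `Γ` the Christoffel
  map of `ChartCalculus.lean` (O'Neill 1983, Ch. 3, Def. 3.16–3.17 with Prop. 3.13; the abstract
  formula is `covDeriv₂_apply_holds`);
* `OpensChart.divergence_eq_sum` — the divergence in a basis `β` with Gram matrix `𝒢`:
  `(div_h k)(Y₀) = Σ_{ij} (𝒢⁻¹)_{ji} (∇_{β_j} k)(β_i, Y₀)` (O'Neill 1983, Ch. 3, p. 86);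
* `OpensChart.momentumConstraintFn_eq_sum` — the momentum constraint covector
  `div_h k − d tr_h k` (`InitialDataSet.momentumConstraintFn`; Bartnik–Isenberg 2004, (2.2)) in a
  basis, for representatives `G, K, T` of `h, k, tr_h k`;
* `OpensChart.traceK_eq_sum_of_flat`, `OpensChart.momentumConstraintFn_eq_of_flat` — **the flat
  case**: if `h ≡ δ` on `U ⊆ F` (`F` a Euclidean space) then `tr_h k = Σ_i K(β_i, β_i)` and
  `(div_h k − d tr_h k)(Y₀) = Σ_i ∂_{β_i} K(β_i, Y₀) − ∂_{Y₀} Σ_i K(β_i, β_i)` in any orthonormal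
  basis, i.e. `Σ_i ∂_i (K_{ij} − δ_{ij} tr_δ K) = ∂_i π^{ij}` for `Y₀ = β_j`: the momentum
  constraint map at the flat metric *is* the linearised momentum-constraint operator
  `π ↦ ∂_i π^{ij}` of Mao–Oh–Tao 2023, (2.1) and (2.5) (and, the constraint map vanishing
  identically at `k = 0`, this is its full linearisation at `(δ, 0)`).

Everything is proved; no definitions, no named facts. This is the momentum-constraint
counterpart of the coordinate formula for the scalar curvature (`ChartScalarCurvature.lean`,
`ScalarCurvatureLinearization.lean`) on the critical path of the annular gluing theorem
(`ObstructionFreeGluing.lean`).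

## References

* B. O'Neill, *Semi-Riemannian geometry with applications to relativity*, Academic Press 1983,
  Ch. 3, Prop. 3.13, Def. 3.16–3.17, p. 86 (key `ONeill1983`).
* R. Bartnik, J. Isenberg, *The constraint equations* (2004), §2, (2.2) (key `BartnikIsenberg2004`).
* Y. Mao, S.-J. Oh, T. Tao, *Initial data gluing in the asymptotically flat regime via solution
  operators with prescribed support properties*, arXiv:2308.13031 (2023), §2.1, (2.1), (2.5)
  (key `MaoOhTao2023`).
-/

noncomputable section

open Bundle Set TopologicalSpace
open scoped Manifold ContDiff Topology BigOperators

namespace Literature.Geometry.Lorentzian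

namespace OpensChart

variable {E : Type*} [NormedAddCommGroup E] [NormedSpace ℝ E] [FiniteDimensional ℝ E]
  [CompleteSpace E] {U : Opens E}

section CovDeriv

variable {n : ℕ∞ω} [Fact (1 ≤ n)]
  {g : PseudoRiemannianMetric 𝓘(ℝ, E) n E (TangentSpace 𝓘(ℝ, E) : U → Type _)}
  {G : E → E →L[ℝ] E →L[ℝ] ℝ} (hG : ∀ y : U, g.val y = G y)
  {k : Π y : U, TangentSpace 𝓘(ℝ, E) y →L[ℝ] TangentSpace 𝓘(ℝ, E) y →L[ℝ] ℝ}
  {K : E → E →L[ℝ] E →L[ℝ] ℝ} (hK : ∀ (y : U) (v w : E), k y v w = K y v w)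
include hG hK

/-- **The covariant differential of a field of bilinear forms on a chart domain, in coordinates**:
for a metric with components `g_y = G y` and a field of bilinear forms with components `k_y = K y`,
both differentiable at `x` (and `k` differentiable as a section), on constant fields
`(∇_Z k)(X, Y)(x) = ∂_Z K(X, Y) − K(Γ_x(Z, X), Y) − K(X, Γ_x(Z, Y))`, `Γ_x(Z, X) = christoffel g G x X Z`
(O'Neill's `(DA)(X, Y, V) = V(A(X,Y)) − A(D_V X, Y) − A(X, D_V Y)`, `covDeriv₂_apply_holds`, with
`D_{∂_i} ∂_j = Γ^k_{ij} ∂_k`, `leviCivita_const_apply`). [cite: ONeill1983, Ch. 3, Def. 3.16–3.17 and Prop. 3.13] -/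
theorem covDeriv₂_eq [g.HasLeviCivita] (x : U) (hGx : DifferentiableAt ℝ G x)
    (hKx : DifferentiableAt ℝ K x)
    (hk : MDifferentiableAt 𝓘(ℝ, E) (𝓘(ℝ, E).prod 𝓘(ℝ, E →L[ℝ] E →L[ℝ] ℝ))
      (fun y ↦ TotalSpace.mk' (E →L[ℝ] E →L[ℝ] ℝ)
        (E := fun y : U ↦ TangentSpace 𝓘(ℝ, E) y →L[ℝ] TangentSpace 𝓘(ℝ, E) y →L[ℝ] ℝ) y (k y)) x)
    (X Y Z : E) :
    g.covDeriv₂ k x X Y Z =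
      fderiv ℝ K x Z X Y - K x (christoffel g G x X Z) Y - K x X (christoffel g G x Y Z) := by
  have happ := PseudoRiemannianMetric.covDeriv₂_apply_holds (g := g) (x := x) (k := k) hk
    (X := fun _ ↦ X) (Y := fun _ ↦ Y) (Z := fun _ ↦ Z)
    (mdifferentiableAt_const_section x X) (mdifferentiableAt_const_section x Y)
    (mdifferentiableAt_const_section x Z)
  rw [show g.covDeriv₂ k x X Y Z = g.covDeriv₂ k x ((fun _ : U ↦ X) x) ((fun _ : U ↦ Y) x)
    ((fun _ : U ↦ Z) x) from rfl, happ]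
  unfold PseudoRiemannianMetric.covDeriv₂Aux
  rw [leviCivita_const_apply hG x hGx, leviCivita_const_apply hG x hGx,
    mvfderiv_eq x (fun y' : U ↦ k y' X Y) (fun y' : E ↦ K y' X Y) (fun y' ↦ hK y' X Y)
      (differentiableAt_apply₂ K hKx X Y),
    fderiv_apply₂ K hKx, hK, hK]

/-- **The divergence of a field of bilinear forms on a chart domain, in a basis** `β` with Gram
matrix `𝒢_{ij} = G_x(β_i, β_j)`:
`(div_g k)_x(Y₀) = Σ_{ij} (𝒢⁻¹)_{ji} [∂_{β_j} K(β_i, Y₀) − K(Γ_x(β_j, β_i), Y₀) − K(β_i, Γ_x(β_j, Y₀))]`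
(`g^{ij} (∇_{e_i} k)(e_j, Y₀)`, the metric trace `trace_eq_sum_gram_inv` of `covDeriv₂_eq`).
[cite: ONeill1983, Ch. 3, p. 86] -/
theorem divergence_eq_sum [g.HasLeviCivita] {ι : Type*} [Fintype ι] [DecidableEq ι] (x : U)
    (hGx : DifferentiableAt ℝ G x) (hKx : DifferentiableAt ℝ K x)
    (hk : MDifferentiableAt 𝓘(ℝ, E) (𝓘(ℝ, E).prod 𝓘(ℝ, E →L[ℝ] E →L[ℝ] ℝ))
      (fun y ↦ TotalSpace.mk' (E →L[ℝ] E →L[ℝ] ℝ)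
        (E := fun y : U ↦ TangentSpace 𝓘(ℝ, E) y →L[ℝ] TangentSpace 𝓘(ℝ, E) y →L[ℝ] ℝ) y (k y)) x)
    (β : Module.Basis ι ℝ E) (Y₀ : E) :
    g.divergence k x Y₀ = ∑ i, ∑ j, (Matrix.of fun i j ↦ G x (β i) (β j))⁻¹ j i *
      (fderiv ℝ K x (β j) (β i) Y₀ - K x (christoffel g G x (β i) (β j)) Y₀
        - K x (β i) (christoffel g G x Y₀ (β j))) := by
  rw [PseudoRiemannianMetric.divergence_apply, trace_eq_sum_gram_inv g x β]
  simp only [hG, PseudoRiemannianMetric.divergenceAux_apply, covDeriv₂_eq hG hK x hGx hKx hk]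
  rfl

end CovDeriv

/-! ### The momentum constraint covector of data on a chart domain -/

section Momentum

variable (D : InitialDataSet 𝓘(ℝ, E) U) {G K : E → E →L[ℝ] E →L[ℝ] ℝ} {T : E → ℝ}
  (hG : ∀ y : U, D.metric.val y = G y) (hK : ∀ (y : U) (v w : E), D.k y v w = K y v w)
  (hT : ∀ y : U, D.traceK y = T y)
include hG hK hT

/-- **The momentum constraint covector of data on a chart domain, in a basis**: for
representatives `G, K, T` of `h, k, tr_h k` differentiable at `x` and a basis `β` with Gram matrix
`𝒢_{ij} = G_x(β_i, β_j)`,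
`(div_h k − d tr_h k)_x(Y₀) = Σ_{ij} (𝒢⁻¹)_{ji} [∂_{β_j} K(β_i, Y₀) − K(Γ_x(β_j, β_i), Y₀) − K(β_i, Γ_x(β_j, Y₀))] − ∂_{Y₀} T`
(Bartnik–Isenberg (2.2), `∇^j k_{ij} − ∇_i tr k`, in coordinates; `divergence_eq_sum` and
`OpensChart.mfderiv_eq`; `k` is differentiable as a section because data are smooth,
`InitialDataSet.contMDiff_k`). [cite: BartnikIsenberg2004, §2, (2.2)] -/
theorem momentumConstraintFn_eq_sum [D.metric.HasLeviCivita] {ι : Type*} [Fintype ι] [DecidableEq ι]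
    (x : U) (hGx : DifferentiableAt ℝ G x) (hKx : DifferentiableAt ℝ K x) (hTx : DifferentiableAt ℝ T x)
    (β : Module.Basis ι ℝ E) (Y₀ : E) :
    D.momentumConstraintFn x Y₀ =
      (∑ i, ∑ j, (Matrix.of fun i j ↦ G x (β i) (β j))⁻¹ j i *
        (fderiv ℝ K x (β j) (β i) Y₀ - K x (christoffel D.metric G x (β i) (β j)) Y₀
          - K x (β i) (christoffel D.metric G x Y₀ (β j))))
      - fderiv ℝ T x Y₀ := by
  have hk := (D.contMDiff_k x).mdifferentiableAt (by simp)
  rw [InitialDataSet.momentumConstraintFn_apply, divergence_eq_sum hG hK x hGx hKx hk β Y₀,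
    mfderiv_eq x D.traceK T hT hTx]
  rfl

end Momentum

/-! ### The flat metric: the momentum constraint is the linearised operator `π ↦ ∂_i π^{ij}` -/

section Flat

variable {F : Type*} [NormedAddCommGroup F] [InnerProductSpace ℝ F] [FiniteDimensional ℝ F]
  [CompleteSpace F] {V : Opens F} {n : ℕ∞ω} [Fact (1 ≤ n)]
  {g : PseudoRiemannianMetric 𝓘(ℝ, F) n F (TangentSpace 𝓘(ℝ, F) : V → Type _)}

omit [FiniteDimensional ℝ F] [CompleteSpace F] in
/-- The Koszul form of metric components with vanishing derivative at `x` is zero (all three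
terms are derivatives of `G`). [cite: ONeill1983, Ch. 3, Prop. 3.13] -/
theorem koszulForm_eq_zero_of_fderiv_eq_zero {G : F → F →L[ℝ] F →L[ℝ] ℝ} {x : F}
    (h : fderiv ℝ G x = 0) (Y₀ : F) : koszulForm G x Y₀ = 0 := by
  refine LinearMap.ext₂ fun X₀ Z₀ ↦ ?_
  simp [koszulForm_apply, h]

omit [CompleteSpace F] [Fact (1 ≤ n)] in
/-- **Christoffel symbols of constant components vanish**: `DG(x) = 0 ⟹ Γ_x = 0`
(`Γ = ♯(½ K)` with `K = 0`). [cite: ONeill1983, Ch. 3, Prop. 3.13] -/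
theorem christoffel_eq_zero_of_fderiv_eq_zero {G : F → F →L[ℝ] F →L[ℝ] ℝ} (x : V)
    (h : fderiv ℝ G x = 0) (Y₀ : F) : christoffel g G x Y₀ = 0 := by
  ext X₀
  rw [christoffel_apply, koszulForm_eq_zero_of_fderiv_eq_zero h]
  simp only [smul_zero, LinearMap.zero_apply]
  exact LinearEquiv.map_zero _

omit [FiniteDimensional ℝ F] [CompleteSpace F] in
/-- The Gram matrix of an orthonormal family for the Euclidean scalar product `innerSL` is the
identity matrix. [folklore] -/
theorem gram_innerSL_of_orthonormal {ι : Type*} [Fintype ι] [DecidableEq ι] {β : ι → F}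
    (hβ : Orthonormal ℝ β) :
    (Matrix.of fun i j ↦ (innerSL ℝ (β i) : F →L[ℝ] ℝ) (β j)) = 1 := by
  ext i j
  rw [Matrix.of_apply, innerSL_apply_apply, Matrix.one_apply]
  exact (orthonormal_iff_ite.1 hβ) i j

variable (D : InitialDataSet 𝓘(ℝ, F) V) {K : F → F →L[ℝ] F →L[ℝ] ℝ}
  (hflat : ∀ y : V, D.metric.val y = (innerSL ℝ : F →L[ℝ] F →L[ℝ] ℝ))
  (hK : ∀ (y : V) (v w : F), D.k y v w = K y v w)
include hflat hK

omit [CompleteSpace F] in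
/-- **Mean curvature for flat metric components**: if `h_y = δ` (`innerSL`) on `V`, then in any
orthonormal basis `tr_h k (y) = Σ_i K_y(β_i, β_i) = tr_δ K` (`trace_eq_sum_gram_inv` with Gram
matrix `1`). [cite: ONeill1983, Ch. 3, pp. 60–61] -/
theorem traceK_eq_sum_of_flat {ι : Type*} [Fintype ι] [DecidableEq ι] (β : Module.Basis ι ℝ F)
    (hβ : Orthonormal ℝ β) (y : V) :
    D.traceK y = ∑ i, K y (β i) (β i) := by
  rw [InitialDataSet.traceK, trace_eq_sum_gram_inv D.metric y β]
  simp only [hflat, InitialDataSet.kBilin_apply, hK]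
  -- retype the basis vectors at the model space (the tangent spaces are definitionally `F`)
  show ∑ i, ∑ j, (Matrix.of fun i j ↦ (innerSL ℝ (β i) : F →L[ℝ] ℝ) (β j))⁻¹ j i * K y (β i) (β j) =
    ∑ i, K y (β i) (β i)
  simp only [gram_innerSL_of_orthonormal hβ, inv_one, Matrix.one_apply, ite_mul, one_mul, zero_mul,
    Finset.sum_ite_eq', Finset.mem_univ, if_true]

/-- **At the flat metric the momentum constraint covector is the linearised momentum-constraint
operator**:
if `h ≡ δ` on `V`, then for every `C¹` representative `K` of `k` and orthonormal basis `β`,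
`(div_h k − d tr_h k)(Y₀) = Σ_i ∂_{β_i} K(β_i, Y₀) − ∂_{Y₀} Σ_i K(β_i, β_i)`; with `Y₀ = β_j` this is
`Σ_i ∂_i (K_{ij} − δ_{ij} tr_δ K) = ∂_i π^{ij}` (Mao–Oh–Tao (2.1), (2.5) at `h = 0`). Since the momentum constraint
vanishes identically for `k = 0`, this is its full linearisation at `(δ, 0)`.
[cite: MaoOhTao2023, §2.1, (2.1) and (2.5)] -/
theorem momentumConstraintFn_eq_of_flat [D.metric.HasLeviCivita] {ι : Type*} [Fintype ι] [DecidableEq ι]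
    (β : Module.Basis ι ℝ F) (hβ : Orthonormal ℝ β) (x : V) (hKx : DifferentiableAt ℝ K x) (Y₀ : F) :
    D.momentumConstraintFn x Y₀ =
      (∑ i, fderiv ℝ K x (β i) (β i) Y₀) - fderiv ℝ (fun y ↦ ∑ i, K y (β i) (β i)) x Y₀ := by
  have hG : ∀ y : V, D.metric.val y = (fun _ : F ↦ (innerSL ℝ : F →L[ℝ] F →L[ℝ] ℝ)) y := hflat
  have hGx : DifferentiableAt ℝ (fun _ : F ↦ (innerSL ℝ : F →L[ℝ] F →L[ℝ] ℝ)) x :=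
    differentiableAt_const _
  have hTx : DifferentiableAt ℝ (fun y ↦ ∑ i, K y (β i) (β i)) x :=
    DifferentiableAt.fun_sum fun i _ ↦ differentiableAt_apply₂ K hKx (β i) (β i)
  rw [momentumConstraintFn_eq_sum D hG hK (traceK_eq_sum_of_flat D hflat hK β hβ) x hGx hKx hTx β Y₀]
  have h0 : fderiv ℝ (fun _ : F ↦ (innerSL ℝ : F →L[ℝ] F →L[ℝ] ℝ)) (x : F) = 0 := fderiv_const_apply _
  simp only [gram_innerSL_of_orthonormal hβ, inv_one, Matrix.one_apply,
    christoffel_eq_zero_of_fderiv_eq_zero x h0, zero_apply, map_zero, sub_zero, ite_mul, one_mul,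
    zero_mul, Finset.sum_ite_eq', Finset.mem_univ, if_true]

end Flat

end OpensChart

end Literature.Geometry.Lorentzian

end
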